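import Literature.NumberTheory.EllipticCurves.HeegnerPointsKolyvaginPrimaryPointsProofs
import Literature.NumberTheory.EllipticCurves.HeegnerPointsKolyvaginPrimaryProp82Proofs
import Literature.NumberTheory.Automorphic.ChebotarevArtinRepHolds
import HarnessLib

/-!
# `Kolyvagin1990_sha_primary_finite`: the assembly after Čebotarev, Weil and leaf (B)

Sibling proof file (theorems only: no definition, no named fact) for the named fact
`Literature.NumberTheory.EllipticCurves.Kolyvagin1990_sha_primary_finite N W K`
(`HeegnerPointsKolyvaginProofs`; B. H. Gross, *Kolyvagin's work on modular elliptic curves*, LMS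
Lecture Note Ser. 153 (1991), Thm. 1.3 (2), `p`-primary part: *"the group `Ш(E/K)` is finite"*;
W. G. McCallum, *Kolyvagin's work on Shafarevich–Tate groups*, same volume, §1 Theorem and §5).

The tree's reduction of the fact along the printed proof (Gross §§3–6, McCallum §§4–5 at level
`p^M`) had reached `KolyvaginDescent.Kolyvagin1990_sha_primary_finite_of_pointsM_of_thmA`
(`HeegnerPointsKolyvaginPrimaryPointsProofs`), whose hypotheses were: the Čebotarev density
theorem (`Automorphic.chebotarev_artinRep`), the Weil pairings (`exists_weilPairing`), the leaf
`Kolyvagin1990_thmA_of_hasCM_or_discr` (the cases Gross sets aside), the point-level leaf (A')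
(Heegner-type points `P_m` over ring class fields with their local behaviour) **including** leaf
(B) (McCallum's Lemma 5.3 with Prop. 2.2 in order form), and [K1] for `p = 2` or `ρ̄_{E,p}` not
onto. Since then three of these inputs became theorems of the tree:

* `Automorphic.chebotarev_artinRep_holds` (`Automorphic/ChebotarevArtinRepHolds`);
* `WeierstrassCurve.exists_weilPairing_holds` (`WeilPairingProofs`);
* `hdual_of_kolyvaginReciprocityM` (`HeegnerPointsKolyvaginPrimaryProp82Proofs`): leaf (B) at
  every level `p^M`, verbatim, from **Kolyvagin reciprocity (R)_M at `λ`** — McCallum's Prop. 2.2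
  (*"`Σ_v ⟨s_v, c_v⟩ = 0`"*, the reciprocity law for `Br(K)`) made explicit at `λ` by local Tate
  duality and Kolyvagin's formula (7.6) of Gross §7: for an alternating left-non-degenerate
  pairing `e` on `E_{p^M}`, `e([s, F], [c', σ]) = 0` for `s` Selmer, `c'` Selmer off `λ`, `F` an
  arithmetic Frobenius at `𝔔 ∣ λ` fixing `E_{p^M}`, `σ ∈ I_𝔔`.

This file records the resulting **current residual form** of the fact:

* `KolyvaginDescent.Kolyvagin1990_sha_primary_finite_of_pointsM_of_reciprocityM` —
  `Kolyvagin1990_sha_primary_finite N W K` follows from (i) the leaf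
  `Kolyvagin1990_thmA_of_hasCM_or_discr N W K`; (ii) leaf (A') *without* its duality clause: for
  `E` non-CM, `d_K ∉ {-3, -4}`, `p` odd with `ρ̄_{E,p}` onto, `M ≥ 1`: subgroups `A_m ⊆ E(K̄)`
  (printed `E(K_m)`) and points `P_m` with McCallum's (4), `P_1 = y_K`, Gross's Props. 5.3 and
  5.4 (1), and the local statements McCallum Lemma 4.3 / Gross Prop. 6.2 (1) at `v ∤ m` and
  McCallum Prop. 4.4 at `λ ∣ m` about their Kolyvagin classes — i.e. CM theory on `X₀(N)` with the
  Eichler–Shimura congruence (Gross Prop. 3.7) and Néron-model/reduction arguments (Gross §6),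
  not in the tree; (iii) **(R)_M** at every Kolyvagin prime of level `M`; (iv) [K1, Thm. A] for
  `p = 2` or `ρ̄_{E,p}` not surjective (non-CM, `d_K ∉ {-3, -4}`), cite-only (not held).

No named fact is introduced (D-0026); the net debt delta is `0`.

## References

* [GrossLMS1991] B. H. Gross, *Kolyvagin's work on modular elliptic curves*, in *`L`-functions and
  arithmetic (Durham, 1989)*, LMS Lecture Note Ser. 153, CUP (1991), 235–256: Thm. 1.3, §2,
  §§3–7 ((7.6)), Props. 8.1–8.2 (held `book:editornd-l-functions-arithmetic`, PDF pp. 213–226).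
* [McCallumLMS1991] W. G. McCallum, *Kolyvagin's work on Shafarevich–Tate groups*, same volume,
  295–316: §1 Theorem (Kolyvagin), §2 Prop. 2.2, §4 (Lemmas 4.1, 4.3, Prop. 4.4), §5 (Lemma 5.3)
  (held, PDF pp. 277–286).
* [Kolyvagin1990] V. A. Kolyvagin, *Euler systems*, in *The Grothendieck Festschrift II*, Progr.
  Math. 87 (1990), 435–483, Thm. A (cite only; not held).
* [TateGCFT1967] J. Tate, *Global class field theory*, Ch. VII of Cassels–Fröhlich (1967), §2.4
  (through `Automorphic.chebotarev_artinRep_holds`).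
-/

noncomputable section

open scoped Classical
open WeierstrassCurve NumberField IsDedekindDomain
open Literature.NumberTheory.GaloisRepresentations

universe u

namespace Literature.NumberTheory.EllipticCurves

namespace KolyvaginDescent

variable (N : ℕ) [NeZero N] (W : WeierstrassCurve ℚ) (K : Type u) [Field K] [NumberField K]

/-- **`Kolyvagin1990_sha_primary_finite` from Heegner-type points and Kolyvagin reciprocity.**
The named fact (Gross 1991, Thm. 1.3 (2), `p`-primary part; McCallum 1991, §1) follows from:
(i) the tree's leaf `Kolyvagin1990_thmA_of_hasCM_or_discr` (`E` with CM or `d_K ∈ {-3, -4}`);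
(ii) `hpoints` — for `E` without CM, `d_K ∉ {-3, -4}`, `p` odd with `ρ̄_{E,p}` onto, `M ≥ 1` and
the complex conjugation `c ≠ 1` of `K`: a sign `ε = ±1` with Gross's Prop. 5.3 for `y_K`, a lift
`τ` of `c`, and for every `m` a `Γ_K`- and `τ`-stable `p^M`-torsion-free subgroup `A_m ⊆ E(K̄)`
(printed `E(K_m)`, Gross Lemma 4.3) with a point `P_m`, `[P_m] ∈ (A_m/p^M)^{Γ_K}` (McCallum (4)),
`P_1 = y_K` (Gross (4.1)), `τ P_m ≡ ε(-1)^{f_m} P_m (mod p^M A_m)` at the Kolyvagin levels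
(Prop. 5.4 (1)), the Selmer condition of the Kolyvagin class of `P_m` at `v ∤ m` (McCallum
Lemma 4.3 / Gross Prop. 6.2 (1)) and McCallum's Prop. 4.4 at `λ ∣ m` in order form;
(iii) `hR` — **Kolyvagin reciprocity (R)_M** at every Kolyvagin prime `ℓ` of level `M`
(McCallum Prop. 2.2, *"`Σ_v ⟨s_v, c_v⟩ = 0`"*, at `λ` through local Tate duality and Gross's
(7.6)): an alternating left-non-degenerate biadditive pairing `e` on `E_{p^M}` with
`e([s, F], [c', σ]) = 0` for `s ∈ S_{p^M}(E/K)`, `c'` Selmer off `λ` and at infinity, `F` an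
arithmetic Frobenius at `𝔔 ∣ λ` fixing `E_{p^M}`, `σ ∈ I_𝔔`;
(iv) `hK1` — [K1, Thm. A]: `Ш(E/K)[p^∞]` finite for `p = 2` or `ρ̄_{E,p}` not onto.
The Čebotarev density theorem, the Weil pairing and McCallum's Lemma 5.3 (leaf (B)) — hypotheses
of `Kolyvagin1990_sha_primary_finite_of_pointsM_of_thmA` — are now supplied by the tree
(`Automorphic.chebotarev_artinRep_holds`, `exists_weilPairing_holds`,
`hdual_of_kolyvaginReciprocityM`). [cite: GrossLMS1991, §1 Thm. 1.3 (2), §§3–8]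
[cite: McCallumLMS1991, §1 Theorem (Kolyvagin), §2 Prop. 2.2, §§4–5] -/
theorem Kolyvagin1990_sha_primary_finite_of_pointsM_of_reciprocityM
    (hexc : Kolyvagin1990_thmA_of_hasCM_or_discr N W K)
    (hpoints : ∀ [W.IsElliptic] (_hE : ¬ W.HasCM) (_hK : IsImaginaryQuadratic K)
      (_hD : NumberField.discr K ≠ -3 ∧ NumberField.discr K ≠ -4)
      (_hH : SatisfiesHeegnerHypothesis N K)
      {P : (W.baseChange K).toAffine.Point} (_hP : IsHeegnerPoint N W K P)
      (_hnt : ¬ IsOfFinAddOrder P) {p : ℕ} (_hp : p.Prime) (_hp2 : p ≠ 2)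
      (_hρ : W.HasSurjectiveModNGaloisRep p) {M : ℕ} (_hM : 1 ≤ M)
      (hdiv : ∀ Q : geomPoints (W.baseChange K), ∃ R, ((p ^ M : ℕ) : ℤ) • R = Q)
      (c : K ≃ₐ[ℚ] K) (_hc : c ≠ 1),
      ∃ (ε : ℤ) (τ : AlgebraicClosure K ≃+* AlgebraicClosure K) (hτ : IsLiftOfAut c τ)
        (A : ℕ → AddSubgroup (geomPoints (W.baseChange K)))
        (hA : ∀ m, KolyvaginCocycle.IsAdmissible (Field.absoluteGaloisGroup K) (A m)
          ((p ^ M : ℕ) : ℤ))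
        (Pt : ℕ → geomPoints (W.baseChange K))
        (hPt : ∀ m, Pt m ∈
          KolyvaginCocycle.invPoints (Field.absoluteGaloisGroup K) (A m) ((p ^ M : ℕ) : ℤ)),
        (ε = 1 ∨ ε = -1) ∧
        IsOfFinAddOrder (Affine.Point.map (W' := W) (c : K →ₐ[ℚ] K) P - ε • P) ∧
        (∀ m, ∀ a ∈ A m, hτ.pointsMap W a ∈ A m) ∧
        Pt 1 = toGeomPoints (W.baseChange K) P ∧
        (∀ m : ℕ, Squarefree m →
          (∀ q ∈ m.primeFactors, IsKolyvaginPrime N W K p q ∧ FrobEqFrobInfty W K (p ^ M) q) →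
          (∃ B ∈ A m, hτ.pointsMap W (Pt m) =
            (ε * (-1) ^ m.primeFactors.card) • Pt m + ((p ^ M : ℕ) : ℤ) • B) ∧
          (∀ v : HeightOneSpectrum (𝓞 K), (m : 𝓞 K) ∉ v.asIdeal →
            kolyvaginClass (W.baseChange K) _ hdiv (hA m) (Pt m) (hPt m) ∈
              selmerLocalKer (W.baseChange K) (v.adicCompletion K) ((p ^ M : ℕ) : ℤ)) ∧
          (∀ ℓ : ℕ, ℓ.Prime → ℓ ∣ m → ∀ v : HeightOneSpectrum (𝓞 K), (ℓ : 𝓞 K) ∈ v.asIdeal →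
            ∀ a : ℕ, (((p : ℤ) ^ a) •
                kolyvaginClass (W.baseChange K) _ hdiv (hA m) (Pt m) (hPt m) ∈
                selmerLocalKer (W.baseChange K) (v.adicCompletion K) ((p ^ M : ℕ) : ℤ) ↔
              ((p : ℤ) ^ a) • kolyvaginClass (W.baseChange K) _ hdiv (hA (m / ℓ)) (Pt (m / ℓ))
                  (hPt (m / ℓ)) ∈
                (W.baseChange K).torsionLocalKer (v.adicCompletion K) ((p ^ M : ℕ) : ℤ)))))
    (hR : ∀ [W.IsElliptic] (_hE : ¬ W.HasCM) (_hK : IsImaginaryQuadratic K)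
      (_hD : NumberField.discr K ≠ -3 ∧ NumberField.discr K ≠ -4)
      (_hH : SatisfiesHeegnerHypothesis N K)
      {P : (W.baseChange K).toAffine.Point} (_hP : IsHeegnerPoint N W K P)
      (_hnt : ¬ IsOfFinAddOrder P) {p : ℕ} (_hp : p.Prime) (_hp2 : p ≠ 2)
      (_hρ : W.HasSurjectiveModNGaloisRep p) {M : ℕ} (_hM : 1 ≤ M)
      {ℓ : ℕ} (hℓ : IsKolyvaginPrime N W K p ℓ), FrobEqFrobInfty W K (p ^ M) ℓ →
      ∃ (A : Type u) (_ : AddCommGroup A)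
        (e : geomTorsion (W.baseChange K) ((p ^ M : ℕ) : ℤ) →+
          geomTorsion (W.baseChange K) ((p ^ M : ℕ) : ℤ) →+ A),
        (∀ x, e x x = 0) ∧ (∀ x, (∀ y, e x y = 0) → x = 0) ∧
        ∀ s ∈ selmerGroup (W.baseChange K) ((p ^ M : ℕ) : ℤ),
          ∀ c' : galH1Torsion (W.baseChange K) ((p ^ M : ℕ) : ℤ),
          (∀ v : HeightOneSpectrum (𝓞 K), (ℓ : 𝓞 K) ∉ v.asIdeal →
            c' ∈ selmerLocalKer (W.baseChange K) (v.adicCompletion K) ((p ^ M : ℕ) : ℤ)) →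
          (∀ w : InfinitePlace K,
            c' ∈ selmerLocalKer (W.baseChange K) w.Completion ((p ^ M : ℕ) : ℤ)) →
          ∀ 𝔔 ∈ hℓ.place.primesAbove, ∀ F : Field.absoluteGaloisGroup K,
            IsArithFrobAt (𝓞 K) F 𝔔 →
            F ∈ torsionFixing (W.baseChange K) ((p ^ M : ℕ) : ℤ) →
            ∀ σ ∈ 𝔔.inertia (Field.absoluteGaloisGroup K),
            e (h1Eval (W.baseChange K) ((p ^ M : ℕ) : ℤ) s F)
              (h1Eval (W.baseChange K) ((p ^ M : ℕ) : ℤ) c' σ) = 0)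
    (hK1 : ∀ [W.IsElliptic] (_hE : ¬ W.HasCM)
      (_hD : NumberField.discr K ≠ -3 ∧ NumberField.discr K ≠ -4) (_hK : IsImaginaryQuadratic K)
      (_hH : SatisfiesHeegnerHypothesis N K) {P : (W.baseChange K).toAffine.Point}
      (_hP : IsHeegnerPoint N W K P) (_hnt : ¬ IsOfFinAddOrder P) (p : ℕ) (_hp : p.Prime),
      (p = 2 ∨ ¬ W.HasSurjectiveModNGaloisRep p) →
      Set.Finite {c : (W.baseChange K).sha | ∃ j : ℕ, p ^ j • c = 0}) :
    Kolyvagin1990_sha_primary_finite N W K := by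
  refine Kolyvagin1990_sha_primary_finite_of_pointsM_of_thmA N W K
    Automorphic.chebotarev_artinRep_holds (fun p _ ↦ W.exists_weilPairing_holds p) hexc ?_ hK1
  intro _ hE hK hD hH P hP hnt p hp hp2 hρ M hM hdiv c hc
  obtain ⟨ε, τ, hτ, A, hA, Pt, hPt, hε, h53, hAτ, hPt1, hm⟩ :=
    hpoints hE hK hD hH hP hnt hp hp2 hρ hM hdiv c hc
  exact ⟨ε, τ, hτ, A, hA, Pt, hPt, hε, h53, hAτ, hPt1, hm,
    hdual_of_kolyvaginReciprocityM W hK hP hp hp2 hM hc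
      (fun hℓ hℓM ↦ hR hE hK hD hH hP hnt hp hp2 hρ hM hℓ hℓM)⟩

end KolyvaginDescent

end Literature.NumberTheory.EllipticCurves

end
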